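import Summits.CriticalPhenomena.PercolationContinuityZ3.Theorems.PercNearOneGluingNoHeavyLowerTailSahiOneStepUniformShift
import HarnessLib

/-!
# One-step scheme, `(2′)` half at uniform density — opposite compression: measure consequences, the potential, and the hull

Support file (prover prim-ineq-prove-3 gen 21; `--supports stmt-CriticalPhenomena-4575`; memo
`run/shared/lean/prim/prim-ineq-prove-3/PROOF-2PRIME-UNIFORM.md`, Lemmas 3 and 4).  No definitions, no named facts, no sorries, no `native_decide`.
Continuation of `…SahiOneStepUniformShift` (same conventions: `τ = Equiv.swap e j`, `ω^τ = {x | τ x ∈ ω}`, the compression `C` of `A` towards `e`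
characterised by the hypothesis `hC`).

* **`real_compress_inter_eq` / `real_compress_inter_compress_inter_le`** — for a product measure with `p e = p j` and a `τ`-invariant `G`-determined
  event `X`: `μ(C_A ∩ X) = μ(A ∩ X)` and `μ(C_A ∩ C_B ∩ X) ≤ μ(A ∩ B ∩ X)` (reindex the pattern sum by `τ` and compare orbitwise);
* **`osN_compress_le`** — `n(H; C_A, C_B) ≤ n(H; A, B)` for the threshold slot `H` of `G ∋ e, j` (memo Lemma 3);
* `filter_pat_compress_subset(')` — the pattern families entering the potential of memo Lemma 4 shrink;
* `dominated_hgen` / `dominant_hgen` — `e`-domination / `e`-dominance survive `H`-generation (memo Lemma 4, last sentence).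
-/

noncomputable section

namespace Summit.CriticalPhenomena.PercolationContinuityZ3.Theorems

namespace SahiOneStep

open MeasureTheory Finset
open Literature.Probability.Percolation (DeterminedBy determinedBy_iff)
open Literature.Probability.LatticeModels (prodBernoulli)
open Literature.Probability.Percolation.DecisionTree (ind ind_of_mem ind_of_not_mem ind_nonneg wtW wtW_nonneg)
open Literature.Probability.Percolation.BHK2006 (ind_inter)
open scoped Classical

variable {ι : Type*} [Fintype ι]

/-! ## Measure-level consequences (uniform density on the two coordinates) -/

omit [Fintype ι] in
/-- On patterns, `ind (pat Y) S = ind Y ↑S`. [folklore] -/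
theorem ind_pat_eq (Y : Set (Set ι)) (S : Finset ι) : ind (pat Y) S = ind Y (↑S : Set ι) := by
  by_cases h : (↑S : Set ι) ∈ Y
  · rw [ind_of_mem (mem_pat.2 h), ind_of_mem h]
  · rw [ind_of_not_mem (fun h' => h (mem_pat.1 h')), ind_of_not_mem h]

omit [Fintype ι] in
/-- The swap `τ` maps `G` to itself when `e, j ∈ G`. [folklore] -/
theorem swap_mem_iff {e j : ι} {G : Finset ι} (he : e ∈ G) (hj : j ∈ G) (x : ι) : Equiv.swap e j x ∈ G ↔ x ∈ G := by
  by_cases hxe : x = e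
  · subst hxe; rw [Equiv.swap_apply_left]; exact iff_of_true hj he
  · by_cases hxj : x = j
    · subst hxj; rw [Equiv.swap_apply_right]; exact iff_of_true he hj
    · rw [Equiv.swap_apply_of_ne_of_ne hxe hxj]

omit [Fintype ι] in
/-- Reindexing a pattern sum by the swap. [folklore] -/
theorem sum_powerset_image_swap {e j : ι} {G : Finset ι} (he : e ∈ G) (hj : j ∈ G) (f : Finset ι → ℝ) :
    ∑ S ∈ G.powerset, f (S.image (Equiv.swap e j)) = ∑ S ∈ G.powerset, f S := by
  have hinv : ∀ S : Finset ι, (S.image (Equiv.swap e j)).image (Equiv.swap e j) = S := fun S => by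
    rw [Finset.image_image]
    have : (⇑(Equiv.swap e j) ∘ ⇑(Equiv.swap e j)) = id := funext fun x => Equiv.swap_apply_self _ _ _
    rw [this, Finset.image_id]
  have hmaps : ∀ S ∈ G.powerset, S.image (Equiv.swap e j) ∈ G.powerset := fun S hS => by
    rw [Finset.mem_powerset] at hS ⊢
    intro x hx
    obtain ⟨y, hy, rfl⟩ := Finset.mem_image.1 hx
    exact (swap_mem_iff he hj y).2 (hS hy)
  exact Finset.sum_nbij' (fun S => S.image (Equiv.swap e j)) (fun S => S.image (Equiv.swap e j)) hmaps hmaps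
    (fun S _ => hinv S) (fun S _ => hinv S) (fun S _ => rfl)

omit [Fintype ι] in
/-- With `p e = p j` (`e, j ∈ G`) the pattern weight is swap-invariant. [folklore] -/
theorem wtW_image_swap {e j : ι} {G : Finset ι} (he : e ∈ G) (hj : j ∈ G) (p : ι → ℝ) (hp : p e = p j) (S : Finset ι) :
    wtW G p (S.image (Equiv.swap e j)) = wtW G p S := by
  unfold wtW
  symm
  refine Finset.prod_equiv (Equiv.swap e j) (fun i => (swap_mem_iff he hj i).symm) fun i _ => ?_
  have hmem : Equiv.swap e j i ∈ S.image (Equiv.swap e j) ↔ i ∈ S := by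
    constructor
    · intro h
      obtain ⟨y, hy, hyi⟩ := Finset.mem_image.1 h
      have : y = i := (Equiv.swap e j).injective hyi
      exact this ▸ hy
    · exact fun h => Finset.mem_image_of_mem _ h
  have hpi : p (Equiv.swap e j i) = p i := by
    by_cases hie : i = e
    · subst hie; rw [Equiv.swap_apply_left, hp]
    · by_cases hij : i = j
      · subst hij; rw [Equiv.swap_apply_right, hp]
      · rw [Equiv.swap_apply_of_ne_of_ne hie hij]
  simp only [hmem, hpi]

omit [Fintype ι] in
/-- **Compression preserves the measure on swap-invariant events**: `μ(C ∩ X) = μ(A ∩ X)` for the compression `C` of `A` towards `e` along `j`,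
`p e = p j`, and a `τ`-invariant `X` (all `G`-determined, `e, j ∈ G`). (memo Lemma 3 (a)) [this work] -/
theorem real_compress_inter_eq (p : ι → unitInterval) {e j : ι} {G : Finset ι} (he : e ∈ G) (hj : j ∈ G) (hp : p e = p j)
    {A C X : Set (Set ι)} (hAG : DeterminedBy A (↑G : Set ι)) (hXG : DeterminedBy X (↑G : Set ι))
    (hX : ∀ ω : Set ι, {x : ι | Equiv.swap e j x ∈ ω} ∈ X ↔ ω ∈ X)
    (hC : ∀ ω : Set ι, ω ∈ C ↔ (ω ∈ A ∧ {x : ι | Equiv.swap e j x ∈ ω} ∈ A) ∨ (e ∈ ω ∧ j ∉ ω ∧ (ω ∈ A ∨ {x : ι | Equiv.swap e j x ∈ ω} ∈ A))) :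
    (prodBernoulli p).real (C ∩ X) = (prodBernoulli p).real (A ∩ X) := by
  have hCG : DeterminedBy C (↑G : Set ι) := determinedBy_of_compress he hj hAG hC
  rw [real_eq_sum_wtW_ind p (hCG.inter hXG), real_eq_sum_wtW_ind p (hAG.inter hXG), ← sub_eq_zero, ← Finset.sum_sub_distrib]
  set pr : ι → ℝ := fun i => (p i : ℝ) with hpr
  have hpr : pr e = pr j := by simp only [pr, hp]
  set g : Finset ι → ℝ := fun S => wtW G pr S * ind (pat (C ∩ X)) S - wtW G pr S * ind (pat (A ∩ X)) S with hg
  have hpair : ∀ S : Finset ι, g S + g (S.image (Equiv.swap e j)) = 0 := by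
    intro S
    simp only [hg, wtW_image_swap he hj pr hpr]
    rw [show pat (C ∩ X) = pat C ∩ pat X from rfl, show pat (A ∩ X) = pat A ∩ pat X from rfl]
    simp only [ind_inter, ind_pat_eq, coe_image_swap]
    have hXs : ind X {x : ι | Equiv.swap e j x ∈ (↑S : Set ι)} = ind X (↑S : Set ι) := by
      by_cases h : (↑S : Set ι) ∈ X
      · rw [ind_of_mem h, ind_of_mem ((hX _).2 h)]
      · rw [ind_of_not_mem h, ind_of_not_mem (fun h' => h ((hX _).1 h'))]
    rw [hXs]
    have key := ind_compress_add_ind_compress hC (↑S : Set ι)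
    linear_combination (wtW G pr S * ind X ↑S) * key
  have hsum : ∑ S ∈ G.powerset, g S = ∑ S ∈ G.powerset, g (S.image (Equiv.swap e j)) :=
    (sum_powerset_image_swap he hj g).symm
  have h2 : 2 * ∑ S ∈ G.powerset, g S = 0 := by
    rw [two_mul]
    conv_lhs => arg 2; rw [hsum]
    rw [← Finset.sum_add_distrib]
    exact Finset.sum_eq_zero fun S _ => hpair S
  have : ∑ S ∈ G.powerset, g S = 0 := by linarith
  simpa [hg] using this

omit [Fintype ι] in
/-- **Opposite compressions do not increase common mass**: `μ(C ∩ C' ∩ X) ≤ μ(A ∩ B ∩ X)` for the compression `C` of `A` towards `e`, the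
compression `C'` of `B` towards `j`, `p e = p j`, and a `τ`-invariant `X`. (memo Lemma 3 (c)) [this work] -/
theorem real_compress_inter_compress_inter_le (p : ι → unitInterval) {e j : ι} {G : Finset ι} (he : e ∈ G) (hj : j ∈ G) (hp : p e = p j)
    {A B C C' X : Set (Set ι)} (hAG : DeterminedBy A (↑G : Set ι)) (hBG : DeterminedBy B (↑G : Set ι)) (hXG : DeterminedBy X (↑G : Set ι))
    (hX : ∀ ω : Set ι, {x : ι | Equiv.swap e j x ∈ ω} ∈ X ↔ ω ∈ X)
    (hC : ∀ ω : Set ι, ω ∈ C ↔ (ω ∈ A ∧ {x : ι | Equiv.swap e j x ∈ ω} ∈ A) ∨ (e ∈ ω ∧ j ∉ ω ∧ (ω ∈ A ∨ {x : ι | Equiv.swap e j x ∈ ω} ∈ A)))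
    (hC' : ∀ ω : Set ι, ω ∈ C' ↔ (ω ∈ B ∧ {x : ι | Equiv.swap e j x ∈ ω} ∈ B) ∨ (j ∈ ω ∧ e ∉ ω ∧ (ω ∈ B ∨ {x : ι | Equiv.swap e j x ∈ ω} ∈ B))) :
    (prodBernoulli p).real (C ∩ C' ∩ X) ≤ (prodBernoulli p).real (A ∩ B ∩ X) := by
  have hCG : DeterminedBy C (↑G : Set ι) := determinedBy_of_compress he hj hAG hC
  have hC'' : ∀ ω : Set ι, ω ∈ C' ↔ (ω ∈ B ∧ {x : ι | Equiv.swap j e x ∈ ω} ∈ B) ∨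
      (j ∈ ω ∧ e ∉ ω ∧ (ω ∈ B ∨ {x : ι | Equiv.swap j e x ∈ ω} ∈ B)) := by
    intro ω; rw [Equiv.swap_comm j e]; exact hC' ω
  have hC'G : DeterminedBy C' (↑G : Set ι) := determinedBy_of_compress hj he hBG hC''
  rw [real_eq_sum_wtW_ind p ((hCG.inter hC'G).inter hXG), real_eq_sum_wtW_ind p ((hAG.inter hBG).inter hXG), ← sub_nonpos,
    ← Finset.sum_sub_distrib]
  set pr : ι → ℝ := fun i => (p i : ℝ) with hpr
  have hpr : pr e = pr j := by simp only [pr, hp]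
  have hp0 : ∀ i, 0 ≤ pr i := fun i => (p i).2.1
  have hp1 : ∀ i, pr i ≤ 1 := fun i => (p i).2.2
  set g : Finset ι → ℝ := fun S => wtW G pr S * ind (pat (C ∩ C' ∩ X)) S - wtW G pr S * ind (pat (A ∩ B ∩ X)) S with hg
  have hpair : ∀ S : Finset ι, g S + g (S.image (Equiv.swap e j)) ≤ 0 := by
    intro S
    simp only [hg, wtW_image_swap he hj pr hpr]
    rw [show pat (C ∩ C' ∩ X) = pat (C ∩ C') ∩ pat X from rfl, show pat (A ∩ B ∩ X) = pat (A ∩ B) ∩ pat X from rfl]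
    simp only [ind_inter (pat (C ∩ C')) (pat X), ind_inter (pat (A ∩ B)) (pat X), ind_pat_eq, coe_image_swap]
    have hXs : ind X {x : ι | Equiv.swap e j x ∈ (↑S : Set ι)} = ind X (↑S : Set ι) := by
      by_cases h : (↑S : Set ι) ∈ X
      · rw [ind_of_mem h, ind_of_mem ((hX _).2 h)]
      · rw [ind_of_not_mem h, ind_of_not_mem (fun h' => h ((hX _).1 h'))]
    rw [hXs]
    have key := ind_compress_inter_le hC hC' (↑S : Set ι)
    have hw : 0 ≤ wtW G pr S * ind X ↑S := mul_nonneg (wtW_nonneg G hp0 hp1 S) (ind_nonneg _ _)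
    nlinarith [key, hw]
  have hsum : ∑ S ∈ G.powerset, g S = ∑ S ∈ G.powerset, g (S.image (Equiv.swap e j)) :=
    (sum_powerset_image_swap he hj g).symm
  have h2 : 2 * ∑ S ∈ G.powerset, g S ≤ 0 := by
    rw [two_mul]
    conv_lhs => arg 2; rw [hsum]
    rw [← Finset.sum_add_distrib]
    exact Finset.sum_nonpos fun S _ => hpair S
  have : ∑ S ∈ G.powerset, g S ≤ 0 := by linarith
  simpa [hg] using this

/-! ## The threshold slot is swap-invariant; compression does not increase `n` -/

omit [Fintype ι] in
/-- The swap is a trade: for `e ∉ ω ∋ j`, `ω^τ = (ω ∖ {j}) ∪ {e}`. [folklore] -/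
theorem swapSet_eq_trade {e j : ι} {ω : Set ι} (he : e ∉ ω) (hj : j ∈ ω) :
    {x : ι | Equiv.swap e j x ∈ ω} = (ω \ {j}) ∪ {e} := by
  ext x
  simp only [Set.mem_setOf_eq, Set.mem_union, Set.mem_sdiff, Set.mem_singleton_iff]
  by_cases hxe : x = e
  · subst hxe; rw [Equiv.swap_apply_left]; exact ⟨fun _ => Or.inr rfl, fun _ => hj⟩
  · by_cases hxj : x = j
    · subst hxj; rw [Equiv.swap_apply_right]
      exact ⟨fun h => absurd h he, fun h => h.elim (fun h => absurd rfl h.2) (fun h => absurd h hxe)⟩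
    · rw [Equiv.swap_apply_of_ne_of_ne hxe hxj]
      exact ⟨fun h => Or.inl ⟨h, hxj⟩, fun h => h.elim (fun h => h.1) (fun h => absurd h hxe)⟩

omit [Fintype ι] in
/-- The swap is a trade: for `e ∈ ω ∌ j`, `ω^τ = (ω ∖ {e}) ∪ {j}`. [folklore] -/
theorem swapSet_eq_trade' {e j : ι} {ω : Set ι} (he : e ∈ ω) (hj : j ∉ ω) :
    {x : ι | Equiv.swap e j x ∈ ω} = (ω \ {e}) ∪ {j} := by
  rw [Equiv.swap_comm]; exact swapSet_eq_trade hj he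

omit [Fintype ι] in
/-- Counting inside `G` is swap-invariant (`e, j ∈ G`). [folklore] -/
theorem card_filter_swapSet {e j : ι} {G : Finset ι} (he : e ∈ G) (hj : j ∈ G) (ω : Set ι) :
    (G.filter (fun x => Equiv.swap e j x ∈ ω)).card = (G.filter (· ∈ ω)).card := by
  have h : G.filter (fun x => Equiv.swap e j x ∈ ω) = (G.filter (· ∈ ω)).image (Equiv.swap e j) := by
    ext x
    simp only [Finset.mem_filter, Finset.mem_image]
    constructor
    · rintro ⟨hxG, hx⟩
      exact ⟨Equiv.swap e j x, ⟨(swap_mem_iff he hj x).2 hxG, hx⟩, Equiv.swap_apply_self _ _ _⟩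
    · rintro ⟨y, ⟨hyG, hy⟩, rfl⟩
      rw [Equiv.swap_apply_self]
      exact ⟨(swap_mem_iff he hj y).2 hyG, hy⟩
  rw [h, Finset.card_image_of_injective _ (Equiv.swap e j).injective]

omit [Fintype ι] in
/-- The threshold slot of `G` is swap-invariant (`e, j ∈ G`). [folklore] -/
theorem swapSet_mem_threshold_iff {e j : ι} {G : Finset ι} (he : e ∈ G) (hj : j ∈ G) (t : ℕ) (ω : Set ι) :
    {x : ι | Equiv.swap e j x ∈ ω} ∈ {ω : Set ι | t ≤ (G.filter (· ∈ ω)).card} ↔ ω ∈ {ω : Set ι | t ≤ (G.filter (· ∈ ω)).card} := by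
  simp only [Set.mem_setOf_eq, card_filter_swapSet he hj ω]

/-- **Opposite compression does not increase `n`** (memo Lemma 3): for the threshold slot `H` of a block `G ∋ e, j` with `p e = p j`,
`n(H; C_A, C_B) ≤ n(H; A, B)`. [this work] -/
theorem osN_compress_le (p : ι → unitInterval) {e j : ι} {G : Finset ι} (he : e ∈ G) (hj : j ∈ G) (hp : p e = p j) (t : ℕ)
    {A B C C' : Set (Set ι)} (hAG : DeterminedBy A (↑G : Set ι)) (hBG : DeterminedBy B (↑G : Set ι))
    (hC : ∀ ω : Set ι, ω ∈ C ↔ (ω ∈ A ∧ {x : ι | Equiv.swap e j x ∈ ω} ∈ A) ∨ (e ∈ ω ∧ j ∉ ω ∧ (ω ∈ A ∨ {x : ι | Equiv.swap e j x ∈ ω} ∈ A)))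
    (hC' : ∀ ω : Set ι, ω ∈ C' ↔ (ω ∈ B ∧ {x : ι | Equiv.swap e j x ∈ ω} ∈ B) ∨ (j ∈ ω ∧ e ∉ ω ∧ (ω ∈ B ∨ {x : ι | Equiv.swap e j x ∈ ω} ∈ B))) :
    osN p {ω : Set ι | t ≤ (G.filter (· ∈ ω)).card} (ind C) (ind C') ≤
      osN p {ω : Set ι | t ≤ (G.filter (· ∈ ω)).card} (ind A) (ind B) := by
  set H : Set (Set ι) := {ω : Set ι | t ≤ (G.filter (· ∈ ω)).card} with hH
  have hHG : DeterminedBy H (↑G : Set ι) := determinedBy_threshold G t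
  have hHτ : ∀ ω : Set ι, {x : ι | Equiv.swap e j x ∈ ω} ∈ H ↔ ω ∈ H := swapSet_mem_threshold_iff he hj t
  have huniv : DeterminedBy (Set.univ : Set (Set ι)) (↑G : Set ι) := (determinedBy_iff _ _).2 fun _ _ _ => by simp
  have hC'' : ∀ ω : Set ι, ω ∈ C' ↔ (ω ∈ B ∧ {x : ι | Equiv.swap j e x ∈ ω} ∈ B) ∨
      (j ∈ ω ∧ e ∉ ω ∧ (ω ∈ B ∨ {x : ι | Equiv.swap j e x ∈ ω} ∈ B)) := by
    intro ω; rw [Equiv.swap_comm j e]; exact hC' ω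
  have hHτ' : ∀ ω : Set ι, {x : ι | Equiv.swap j e x ∈ ω} ∈ H ↔ ω ∈ H := by
    intro ω; rw [Equiv.swap_comm j e]; exact hHτ ω
  -- the five measures entering `osN_ind_ind`
  have e1 : (prodBernoulli p).real (H ∩ C) = (prodBernoulli p).real (H ∩ A) := by
    rw [Set.inter_comm H C, Set.inter_comm H A]; exact real_compress_inter_eq p he hj hp hAG hHG hHτ hC
  have e2 : (prodBernoulli p).real (H ∩ C') = (prodBernoulli p).real (H ∩ B) := by
    rw [Set.inter_comm H C', Set.inter_comm H B]; exact real_compress_inter_eq p hj he hp.symm hBG hHG hHτ' hC''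
  have e3 : (prodBernoulli p).real C = (prodBernoulli p).real A := by
    have h := real_compress_inter_eq p he hj hp hAG huniv (fun _ => by simp) hC
    simp only [Set.inter_univ] at h; exact h
  have e4 : (prodBernoulli p).real C' = (prodBernoulli p).real B := by
    have h := real_compress_inter_eq p hj he hp.symm hBG huniv (fun _ => by simp) hC''
    simp only [Set.inter_univ] at h; exact h
  have e5 : (prodBernoulli p).real (H ∩ C ∩ C') ≤ (prodBernoulli p).real (H ∩ A ∩ B) := by
    have h := real_compress_inter_compress_inter_le p he hj hp hAG hBG hHG hHτ hC hC'
    have eqL : C ∩ C' ∩ H = H ∩ C ∩ C' := by ext ω; simp only [Set.mem_inter_iff]; tauto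
    have eqR : A ∩ B ∩ H = H ∩ A ∩ B := by ext ω; simp only [Set.mem_inter_iff]; tauto
    rw [eqL, eqR] at h
    exact h
  rw [osN_ind_ind, osN_ind_ind, e1, e2, e3, e4]
  have hH1 : (prodBernoulli p).real H ≤ 1 := measureReal_le_one
  nlinarith [e5, hH1]

/-! ## The potential (memo Lemma 4) -/

omit [Fintype ι] in
/-- Patterns of the compression towards `e` avoiding `e` are patterns of `A` avoiding `e`. [this work] -/
theorem filter_pat_compress_subset {e j : ι} {G : Finset ι} {A C : Set (Set ι)}
    (hC : ∀ ω : Set ι, ω ∈ C ↔ (ω ∈ A ∧ {x : ι | Equiv.swap e j x ∈ ω} ∈ A) ∨ (e ∈ ω ∧ j ∉ ω ∧ (ω ∈ A ∨ {x : ι | Equiv.swap e j x ∈ ω} ∈ A))) :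
    G.powerset.filter (fun S : Finset ι => ((↑S : Set ι) ∈ C ∧ e ∉ S)) ⊆ G.powerset.filter (fun S : Finset ι => ((↑S : Set ι) ∈ A ∧ e ∉ S)) := by
  intro S hS
  rw [Finset.mem_filter] at hS ⊢
  refine ⟨hS.1, ?_, hS.2.2⟩
  rcases (hC _).1 hS.2.1 with ⟨h, _⟩ | ⟨h, _, _⟩
  · exact h
  · exact absurd (by exact_mod_cast h : e ∈ S) hS.2.2

omit [Fintype ι] in
/-- Patterns of the compression towards `j` containing `e` are patterns of `B` containing `e`. [this work] -/
theorem filter_pat_compress_subset' {e j : ι} {G : Finset ι} {B C' : Set (Set ι)}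
    (hC' : ∀ ω : Set ι, ω ∈ C' ↔ (ω ∈ B ∧ {x : ι | Equiv.swap e j x ∈ ω} ∈ B) ∨ (j ∈ ω ∧ e ∉ ω ∧ (ω ∈ B ∨ {x : ι | Equiv.swap e j x ∈ ω} ∈ B))) :
    G.powerset.filter (fun S : Finset ι => ((↑S : Set ι) ∈ C' ∧ e ∈ S)) ⊆ G.powerset.filter (fun S : Finset ι => ((↑S : Set ι) ∈ B ∧ e ∈ S)) := by
  intro S hS
  rw [Finset.mem_filter] at hS ⊢
  refine ⟨hS.1, ?_, hS.2.2⟩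
  rcases (hC' _).1 hS.2.1 with ⟨h, _⟩ | ⟨_, h, _⟩
  · exact h
  · exact absurd (by exact_mod_cast hS.2.2 : e ∈ (↑S : Set ι)) h

/-! ## Dominance survives `H`-generation (memo Lemma 4, last sentence) -/

omit [Fintype ι] in
/-- Trading a present coordinate of `G` for an absent one keeps the count inside `G`. [folklore] -/
theorem card_filter_trade {a b : ι} {G : Finset ι} (ha : a ∈ G) (hb : b ∈ G) {z : Set ι} (haz : a ∈ z) (hbz : b ∉ z) :
    (G.filter (· ∈ (z \ {a}) ∪ {b})).card = (G.filter (· ∈ z)).card := by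
  have hab : a ≠ b := fun h => hbz (h ▸ haz)
  have h : G.filter (· ∈ (z \ {a}) ∪ {b}) = insert b ((G.filter (· ∈ z)).erase a) := by
    ext x
    simp only [Finset.mem_filter, Finset.mem_insert, Finset.mem_erase, Set.mem_union, Set.mem_sdiff, Set.mem_singleton_iff]
    constructor
    · rintro ⟨hx, ⟨hxz, hxa⟩ | hxb⟩
      · exact Or.inr ⟨hxa, hx, hxz⟩
      · exact Or.inl hxb
    · rintro (hxb | ⟨hxa, hx, hxz⟩)
      · exact ⟨hxb ▸ hb, Or.inr hxb⟩
      · exact ⟨hx, Or.inl ⟨hxz, hxa⟩⟩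
  have hamem : a ∈ G.filter (· ∈ z) := Finset.mem_filter.2 ⟨ha, haz⟩
  have hbmem : b ∉ (G.filter (· ∈ z)).erase a := fun h => hbz (Finset.mem_filter.1 (Finset.mem_of_mem_erase h)).2
  rw [h, Finset.card_insert_of_notMem hbmem, Finset.card_erase_of_mem hamem]
  have hpos : 0 < (G.filter (· ∈ z)).card := Finset.card_pos.2 ⟨a, hamem⟩
  omega

omit [Fintype ι] in
/-- **`e`-domination survives `H`-generation**: if every `j`-trade of a member of `B` containing `e` stays in `B`, the same holds for the
`H`-generated hull of `B` (`H` the threshold slot of `G ∋ e, j`). [this work] -/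
theorem dominated_hgen {e j : ι} {G : Finset ι} (he : e ∈ G) (hj : j ∈ G) (hej : e ≠ j) (t : ℕ) {B : Set (Set ι)}
    (hdom : ∀ ω ∈ B, e ∈ ω → j ∉ ω → (ω \ {e}) ∪ {j} ∈ B) :
    ∀ ω ∈ {ω : Set ι | ∀ ω' : Set ι, ω ⊆ ω' → ω' ∈ {ω : Set ι | t ≤ (G.filter (· ∈ ω)).card} → ω' ∈ B},
      e ∈ ω → j ∉ ω → (ω \ {e}) ∪ {j} ∈ {ω : Set ι | ∀ ω' : Set ι, ω ⊆ ω' → ω' ∈ {ω : Set ι | t ≤ (G.filter (· ∈ ω)).card} → ω' ∈ B} := by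
  intro ω hω heω hjω z hz hzH
  have hjz : j ∈ z := hz (Or.inr rfl)
  by_cases hez : e ∈ z
  · -- `z ⊇ ω`
    refine hω z (fun x hx => ?_) hzH
    by_cases hxe : x = e
    · exact hxe ▸ hez
    · exact hz (Or.inl ⟨hx, hxe⟩)
  · -- trade `j` for `e` in `z`
    have hz₀ : ω ⊆ (z \ {j}) ∪ {e} := by
      intro x hx
      by_cases hxe : x = e
      · exact Or.inr hxe
      · have hxz : x ∈ z := hz (Or.inl ⟨hx, hxe⟩)
        exact Or.inl ⟨hxz, fun hxj => hjω (hxj ▸ hx)⟩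
    have hz₀H : (z \ {j}) ∪ {e} ∈ {ω : Set ι | t ≤ (G.filter (· ∈ ω)).card} := by
      simp only [Set.mem_setOf_eq] at hzH ⊢
      rw [Finset.filter_congr_decidable G (· ∈ (z \ {j}) ∪ {e}) _, card_filter_trade hj he hjz hez]
      rwa [Finset.filter_congr_decidable G (· ∈ z) _] at hzH
    have hz₀B := hω _ hz₀ hz₀H
    have h := hdom _ hz₀B (Or.inr rfl) (fun h => h.elim (fun h => h.2 rfl) (fun h => hej h.symm))
    have heq : ((z \ {j}) ∪ {e}) \ {e} ∪ {j} = z := by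
      ext x
      simp only [Set.mem_union, Set.mem_sdiff, Set.mem_singleton_iff]
      constructor
      · rintro (⟨⟨hx, _⟩ | hx, hxe⟩ | rfl)
        · exact hx
        · exact absurd hx hxe
        · exact hjz
      · intro hx
        by_cases hxj : x = j
        · exact Or.inr hxj
        · exact Or.inl ⟨Or.inl ⟨hx, hxj⟩, fun hxe => hez (hxe ▸ hx)⟩
    rw [heq] at h
    exact h

omit [Fintype ι] in
/-- **`e`-dominance survives `H`-generation**: if every `e`-trade of a member of `A` avoiding `e` stays in `A`, the same holds for the
`H`-generated hull of `A`. [this work] -/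
theorem dominant_hgen {e j : ι} {G : Finset ι} (he : e ∈ G) (hj : j ∈ G) (hej : e ≠ j) (t : ℕ) {A : Set (Set ι)}
    (hdom : ∀ ω ∈ A, e ∉ ω → j ∈ ω → (ω \ {j}) ∪ {e} ∈ A) :
    ∀ ω ∈ {ω : Set ι | ∀ ω' : Set ι, ω ⊆ ω' → ω' ∈ {ω : Set ι | t ≤ (G.filter (· ∈ ω)).card} → ω' ∈ A},
      e ∉ ω → j ∈ ω → (ω \ {j}) ∪ {e} ∈ {ω : Set ι | ∀ ω' : Set ι, ω ⊆ ω' → ω' ∈ {ω : Set ι | t ≤ (G.filter (· ∈ ω)).card} → ω' ∈ A} := by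
  intro ω hω heω hjω z hz hzH
  have hez : e ∈ z := hz (Or.inr rfl)
  by_cases hjz : j ∈ z
  · refine hω z (fun x hx => ?_) hzH
    by_cases hxj : x = j
    · exact hxj ▸ hjz
    · exact hz (Or.inl ⟨hx, hxj⟩)
  · have hz₀ : ω ⊆ (z \ {e}) ∪ {j} := by
      intro x hx
      by_cases hxj : x = j
      · exact Or.inr hxj
      · have hxz : x ∈ z := hz (Or.inl ⟨hx, hxj⟩)
        exact Or.inl ⟨hxz, fun hxe => heω (hxe ▸ hx)⟩
    have hz₀H : (z \ {e}) ∪ {j} ∈ {ω : Set ι | t ≤ (G.filter (· ∈ ω)).card} := by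
      simp only [Set.mem_setOf_eq] at hzH ⊢
      rw [Finset.filter_congr_decidable G (· ∈ (z \ {e}) ∪ {j}) _, card_filter_trade he hj hez hjz]
      rwa [Finset.filter_congr_decidable G (· ∈ z) _] at hzH
    have hz₀A := hω _ hz₀ hz₀H
    have h := hdom _ hz₀A (fun h => h.elim (fun h => h.2 rfl) (fun h => hej h)) (Or.inr rfl)
    have heq : ((z \ {e}) ∪ {j}) \ {j} ∪ {e} = z := by
      ext x
      simp only [Set.mem_union, Set.mem_sdiff, Set.mem_singleton_iff]
      constructor
      · rintro (⟨⟨hx, _⟩ | hx, hxj⟩ | rfl)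
        · exact hx
        · exact absurd hx hxj
        · exact hez
      · intro hx
        by_cases hxe : x = e
        · exact Or.inr hxe
        · exact Or.inl ⟨Or.inl ⟨hx, hxe⟩, fun hxj => hjz (hxj ▸ hx)⟩
    rw [heq] at h
    exact h

end SahiOneStep

end Summit.CriticalPhenomena.PercolationContinuityZ3.Theorems
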